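import Mathlib.RepresentationTheory.Subrepresentation
import Mathlib.RepresentationTheory.Intertwining
import Mathlib.RepresentationTheory.Irreducible
import Mathlib.RingTheory.MvPolynomial.Homogeneous
import Literature.Computability.AlgebraicComplexity.OrbitCoordinateRing
import HarnessLib

/-!
# Representation-theoretic obstructions of GCT: graded pieces of `k[Δ[f]]`,
multiplicity and occurrence obstructions

Trunk T-CPLX-ALG (Literature/Computability/AlgebraicComplexity); definition request
`defn-HasMultiplicityObstruction` (route ValiantsHypothesis/GCTMult, item
stmt-ValiantsHypothesis-0325).

For a form `f` of degree `m` in the variables `σ` over a field `k`, `OrbitCoordinateRing.lean`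
provides the coordinate ring `k[Δ[f]] = OrbitCoordRing f m = k[Sym^m] ⧸ I(GL · f)` with its
`GL σ k`-action `orbitCoordRep f m`. Here:

* `orbitCoordRingDeg f m d ≤ k[Δ[f]]` — the degree-`d` graded piece `k[Δ[f]]_d`, the image of the
  homogeneous degree-`d` polynomial functions on `Sym^m`; it is `GL`-stable
  (`orbitCoordSubrep f m d : Subrepresentation (orbitCoordRep f m)`), giving the
  finite-dimensional `GL σ k`-representation `orbitCoordRepDeg f m d` on `k[Δ[f]]_d`.
* `HasMultiplicityObstruction f g m d` — there is NO surjective `GL`-equivariant linear map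
  `k[Δ[f]]_d ↠ k[Δ[g]]_d` (Mathlib `Representation.IntertwiningMap`).
* `HasOccurrenceObstruction f g m d` — some irreducible subrepresentation of `k[Δ[g]]_d` admits
  no nonzero equivariant map to `k[Δ[f]]_d`.
* the *obstruction principle*, PROVED in-tree: `not_hasMultiplicityObstruction_of_mem_orbitClosure`
  (`g ∈ Δ[f]` ⇒ `I(GL·f) ≤ I(GL·g)` ⇒ restriction `orbitCoordRestrict : k[Δ[f]] → k[Δ[g]]` is an
  equivariant surjection on each degree piece ⇒ no obstruction); only "occurrence ⇒ multiplicity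
  over `ℂ`" (semisimplicity) is a named fact.

Over `k = ℂ` (where rational `GL`-representations are completely reducible, so `k[Δ[f]]_d ≅ ⊕_λ
V_λ^{mult_λ(f,d)}`), `HasMultiplicityObstruction f g m d` is equivalent to
`∃ λ, mult_λ k[Δ[g]]_d > mult_λ k[Δ[f]]_d` (a surjective equivariant map exists iff every
multiplicity of the target is at most that of the source, by Schur's lemma), and
`HasOccurrenceObstruction f g m d` to `∃ λ, mult_λ k[Δ[g]]_d > 0 = mult_λ k[Δ[f]]_d`; occurrence
obstructions are multiplicity obstructions. These equivalences need highest-weight theory not in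
the tree and are recorded, not formalised (Bürgisser–Landsberg–Manivel–Weyman 2011, §2;
Mulmuley–Sohoni 2008; Bürgisser–Ikenmeyer–Panova 2019, §1).

## Sources

* K. Mulmuley, M. Sohoni, *Geometric complexity theory II*, SIAM J. Comput. 38 (2008)
  (representation-theoretic obstructions for orbit-closure containment).
* P. Bürgisser, J. M. Landsberg, L. Manivel, J. Weyman, *An overview of mathematical issues
  arising in the geometric complexity theory approach to VP ≠ VNP*, SIAM J. Comput. 40 (2011),
  §2 (coordinate rings of orbit closures as `GL`-modules, obstructions).
* P. Bürgisser, C. Ikenmeyer, G. Panova, *No occurrence obstructions in geometric complexity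
  theory*, J. AMS 32 (2019), §1 (multiplicity vs occurrence obstructions; the restriction
  epimorphism `ℂ[Δ[det_n]]_d ↠ ℂ[Δ[X^{n-m} per_m]]_d`), Thm. 1.1.

## Design choices

* Equivariant maps are Mathlib's bundled `Representation.IntertwiningMap ρ σ`
  (`toLinearMap ∘ₗ ρ A = σ A ∘ₗ toLinearMap` for all `A`), exactly the requested
  `φ ∘ ρ_f(A) = ρ_g(A) ∘ φ`.
* The graded piece is a `Submodule.map` of Mathlib's `MvPolynomial.homogeneousSubmodule` along
  the quotient map; `GL`-stability is PROVED (`coordSubst` sends degree-`d` forms to degree-`d`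
  forms, `IsHomogeneous.aeval` with linear substitutions), so `orbitCoordRepDeg` is Mathlib's
  `Subrepresentation.toRepresentation`, no junk.
* Irreducibility is Mathlib's `Representation.IsIrreducible` (`IsSimpleOrder` on
  subrepresentations); "λ does not occur in `k[Δ[f]]_d`" is rendered Schur-style as "every
  intertwiner from the irreducible `W` to `k[Δ[f]]_d` vanishes", which over `ℂ` is
  `mult_λ = 0`.
* Everything is over an arbitrary field `k` and finite variable type `σ` as in
  `OrbitCoordinateRing.lean`; statements about `ℂ` specialise.
-/

noncomputable section

open MvPolynomial Representation

namespace Literature.Computability.AlgebraicComplexity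

variable {σ k : Type*} [Fintype σ] [DecidableEq σ] [Field k]

/-! ### Graded pieces of the coordinate ring of an orbit closure -/

/-- Linear substitution of coordinates preserves homogeneity of polynomial functions on `Sym^m`:
`coordSubst m A F` is a form of degree `d` if `F` is (each coordinate is sent to a linear form).
[Bürgisser–Landsberg–Manivel–Weyman 2011, §2 (`GL` acts degree-wise on `ℂ[Sym^m]`)] [folklore] -/
theorem isHomogeneous_coordSubst {m d : ℕ} (A : GL σ k) {F : MvPolynomial (DegIdx σ m) k}
    (hF : F.IsHomogeneous d) : (coordSubst m A F).IsHomogeneous d := by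
  have hg : ∀ c : DegIdx σ m,
      (∑ e : DegIdx σ m, coeff c.1 (linSubstRep σ k A⁻¹ (monomial e.1 1)) •
        (X e : MvPolynomial (DegIdx σ m) k)).IsHomogeneous 1 := fun c => by
    refine IsHomogeneous.sum _ _ 1 fun e _ => ?_
    rw [smul_eq_C_mul]
    exact (isHomogeneous_X k e).C_mul _
  have h := hF.aeval _ hg
  rw [one_mul] at h
  exact h

/-- The degree-`d` graded piece `k[Δ[f]]_d` of the coordinate ring of the orbit closure of `f`
(in degree `m`): the image in `OrbitCoordRing f m` of the homogeneous polynomial functions of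
degree `d` on `Sym^m (k^σ)` (a genuine graded piece when `I(GL · f)` is homogeneous, e.g. over
infinite `k`). [Bürgisser–Ikenmeyer–Panova 2019, §1 (`ℂ[Δ[f]]_d`);
Bürgisser–Landsberg–Manivel–Weyman 2011, §2] [cite: BurgisserIkenmeyerPanova2019, §1] -/
def orbitCoordRingDeg (f : MvPolynomial σ k) (m d : ℕ) : Submodule k (OrbitCoordRing f m) :=
  (homogeneousSubmodule (DegIdx σ m) k d).map
    (Ideal.Quotient.mkₐ k (orbitVanishingIdeal f m)).toLinearMap

/-- Membership in the graded piece: classes of degree-`d` forms. [Bürgisser–Ikenmeyer–Panova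
2019, §1] [folklore] -/
theorem mem_orbitCoordRingDeg_iff {f : MvPolynomial σ k} {m d : ℕ} {x : OrbitCoordRing f m} :
    x ∈ orbitCoordRingDeg f m d ↔ ∃ F : MvPolynomial (DegIdx σ m) k, F.IsHomogeneous d ∧
      Ideal.Quotient.mk (orbitVanishingIdeal f m) F = x := by
  simp only [orbitCoordRingDeg, Submodule.mem_map, mem_homogeneousSubmodule]
  rfl

/-- The graded piece `k[Δ[f]]_d` is stable under the `GL σ k`-action `orbitCoordRep f m`.
[Bürgisser–Landsberg–Manivel–Weyman 2011, §2; Mulmuley–Sohoni 2008] [folklore] -/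
theorem orbitCoordRep_mem_orbitCoordRingDeg (f : MvPolynomial σ k) (m d : ℕ) (A : GL σ k)
    {x : OrbitCoordRing f m} (hx : x ∈ orbitCoordRingDeg f m d) :
    orbitCoordRep f m A x ∈ orbitCoordRingDeg f m d := by
  obtain ⟨F, hF, rfl⟩ := mem_orbitCoordRingDeg_iff.1 hx
  rw [orbitCoordRep_apply, orbitCoordSubst_mk]
  exact mem_orbitCoordRingDeg_iff.2 ⟨_, isHomogeneous_coordSubst A hF, rfl⟩

/-- `k[Δ[f]]_d` as a subrepresentation of `orbitCoordRep f m` (Mathlib `Subrepresentation`).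
[Bürgisser–Landsberg–Manivel–Weyman 2011, §2] [cite: BurgisserLandsbergManivelWeyman2011, §2] -/
def orbitCoordSubrep (f : MvPolynomial σ k) (m d : ℕ) : Subrepresentation (orbitCoordRep f m) where
  toSubmodule := orbitCoordRingDeg f m d
  apply_mem_toSubmodule A _ hx := orbitCoordRep_mem_orbitCoordRingDeg f m d A hx

/-- The `GL σ k`-representation on the degree-`d` piece `k[Δ[f]]_d` of the coordinate ring of the
orbit closure of `f`. [Bürgisser–Ikenmeyer–Panova 2019, §1; Mulmuley–Sohoni 2008] [cite: BurgisserIkenmeyerPanova2019, §1] -/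
def orbitCoordRepDeg (f : MvPolynomial σ k) (m d : ℕ) :
    Representation k (GL σ k) (orbitCoordRingDeg f m d) :=
  (orbitCoordSubrep f m d).toRepresentation

/-- `orbitCoordRepDeg` acts as `orbitCoordRep` on representatives. [folklore] -/
@[simp] theorem orbitCoordRepDeg_apply_coe (f : MvPolynomial σ k) (m d : ℕ) (A : GL σ k)
    (x : orbitCoordRingDeg f m d) :
    (orbitCoordRepDeg f m d A x : OrbitCoordRing f m) = orbitCoordRep f m A x :=
  rfl

/-! ### Obstructions -/

/-- `HasMultiplicityObstruction f g m d`: there is no surjective `GL σ k`-equivariant linear map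
`k[Δ[f]]_d ↠ k[Δ[g]]_d` between the degree-`d` pieces of the coordinate rings of the orbit
closures (in degree `m`) of `f` and `g`. Over `ℂ` this says that some irreducible `V_λ` has
larger multiplicity in `ℂ[Δ[g]]_d` than in `ℂ[Δ[f]]_d` — a *multiplicity obstruction* against
`g ∈ Δ[f]`. [Bürgisser–Ikenmeyer–Panova 2019, §1 (multiplicity obstructions);
Bürgisser–Landsberg–Manivel–Weyman 2011, §2; Mulmuley–Sohoni 2008] [cite: BurgisserIkenmeyerPanova2019, §1] -/
def HasMultiplicityObstruction (f g : MvPolynomial σ k) (m d : ℕ) : Prop :=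
  ¬ ∃ φ : IntertwiningMap (orbitCoordRepDeg f m d) (orbitCoordRepDeg g m d),
      Function.Surjective φ

/-- `HasOccurrenceObstruction f g m d`: some irreducible subrepresentation `W` of `k[Δ[g]]`
contained in the degree-`d` piece `k[Δ[g]]_d` admits no nonzero equivariant map to `k[Δ[f]]_d` (over `ℂ`: some `V_λ` occurs in `ℂ[Δ[g]]_d`
but not in `ℂ[Δ[f]]_d` — an *occurrence obstruction*, the special case
`mult_λ(f) = 0 < mult_λ(g)` of a multiplicity obstruction). [Bürgisser–Ikenmeyer–Panova 2019,
§1 (occurrence obstructions), Thm. 1.1 (none exist for `det_n` vs padded `per_m`, `n > m²⁵`)] [cite: BurgisserIkenmeyerPanova2019, §1] -/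
def HasOccurrenceObstruction (f g : MvPolynomial σ k) (m d : ℕ) : Prop :=
  ∃ W : Subrepresentation (orbitCoordRep g m), W.toSubmodule ≤ orbitCoordRingDeg g m d ∧
    W.toRepresentation.IsIrreducible ∧
      ∀ ψ : IntertwiningMap W.toRepresentation (orbitCoordRepDeg f m d), ψ = 0

/-- Orbit-closure containment shrinks the orbit: if `g ∈ Δ[f]` then every polynomial function on
`Sym^m` vanishing on `GL · f` vanishes on `GL · g`, i.e. `I(GL · f) ≤ I(GL · g)` (so `Δ[g] ⊆ Δ[f]`).
[Bürgisser–Ikenmeyer–Panova 2019, §1; Mulmuley–Sohoni 2001, §4] [folklore] -/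
theorem orbitVanishingIdeal_le_of_mem_orbitClosure {f g : MvPolynomial σ k} {m : ℕ}
    (h : g ∈ orbitClosure f) : orbitVanishingIdeal f m ≤ orbitVanishingIdeal g m := by
  -- first: every `F ∈ I(GL·f)` vanishes at `g` itself
  have hg : ∀ F ∈ orbitVanishingIdeal f m, aeval (formCoeff m g) F = 0 := by
    intro F hF
    have := (mem_orbitClosure_iff.1 h) (rename (fun d : DegIdx σ m => d.1) F) (by
      rintro _ ⟨A, rfl⟩
      rw [aeval_rename]
      exact mem_orbitVanishingIdeal_iff.1 hF A)
    rwa [aeval_rename] at this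
  intro F hF
  rw [mem_orbitVanishingIdeal_iff]
  intro A
  have hmem : coordSubst m A⁻¹ F ∈ orbitVanishingIdeal f m := by
    rw [← orbitVanishingIdeal_map_coordSubst f m A⁻¹]
    exact Ideal.mem_map_of_mem _ hF
  have := hg _ hmem
  rwa [aeval_formCoeff_coordSubst, inv_inv] at this

/-- The restriction map `k[Δ[f]] → k[Δ[g]]` for `g ∈ Δ[f]` (identity on representatives).
[Bürgisser–Ikenmeyer–Panova 2019, §1 (restriction of regular functions)] [folklore] -/
def orbitCoordRestrict {f g : MvPolynomial σ k} (m : ℕ) (h : g ∈ orbitClosure f) :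
    OrbitCoordRing f m →ₐ[k] OrbitCoordRing g m :=
  Ideal.quotientMapₐ (orbitVanishingIdeal g m) (AlgHom.id k _)
    (by simpa using orbitVanishingIdeal_le_of_mem_orbitClosure (m := m) h)

/-- The restriction map on representatives. [folklore] -/
@[simp] theorem orbitCoordRestrict_mk {f g : MvPolynomial σ k} (m : ℕ) (h : g ∈ orbitClosure f)
    (F : MvPolynomial (DegIdx σ m) k) :
    orbitCoordRestrict m h (Ideal.Quotient.mk (orbitVanishingIdeal f m) F) =
      Ideal.Quotient.mk (orbitVanishingIdeal g m) F :=
  rfl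

/-- The restriction map preserves the degree-`d` pieces. [folklore] -/
theorem orbitCoordRestrict_mem {f g : MvPolynomial σ k} (m d : ℕ) (h : g ∈ orbitClosure f)
    {x : OrbitCoordRing f m} (hx : x ∈ orbitCoordRingDeg f m d) :
    orbitCoordRestrict m h x ∈ orbitCoordRingDeg g m d := by
  obtain ⟨F, hF, rfl⟩ := mem_orbitCoordRingDeg_iff.1 hx
  exact mem_orbitCoordRingDeg_iff.2 ⟨F, hF, rfl⟩

/-- **The obstruction principle** (basis of GCT), proved in-tree: if `g` lies in the orbit closure
`Δ[f]` of `f`, then restriction of polynomial functions is a `GL`-equivariant surjection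
`k[Δ[f]]_d ↠ k[Δ[g]]_d` for every `d`, so there is no multiplicity obstruction. Contrapositively,
a multiplicity obstruction in some degree `d` proves `g ∉ Δ[f]`.
[Bürgisser–Ikenmeyer–Panova 2019, §1; Bürgisser–Landsberg–Manivel–Weyman 2011, §2;
Mulmuley–Sohoni 2008] [folklore] -/
theorem not_hasMultiplicityObstruction_of_mem_orbitClosure {f g : MvPolynomial σ k} {m : ℕ}
    (h : g ∈ orbitClosure f) (d : ℕ) : ¬ HasMultiplicityObstruction f g m d := by
  intro hobs
  apply hobs
  let ψ : orbitCoordRingDeg f m d →ₗ[k] orbitCoordRingDeg g m d :=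
    (orbitCoordRestrict m h).toLinearMap.restrict fun x hx => orbitCoordRestrict_mem m d h hx
  refine ⟨⟨ψ, fun A => ?_⟩, ?_⟩
  · apply LinearMap.ext
    intro x
    apply Subtype.ext
    obtain ⟨F, hF⟩ := Ideal.Quotient.mk_surjective (x : OrbitCoordRing f m)
    simp only [ψ, LinearMap.coe_comp, Function.comp_apply, LinearMap.restrict_apply,
      orbitCoordRepDeg_apply_coe, orbitCoordRep_apply, AlgHom.toLinearMap_apply, ← hF,
      orbitCoordSubst_mk, orbitCoordRestrict_mk]
  · rintro ⟨y, hy⟩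
    obtain ⟨F, hF, rfl⟩ := mem_orbitCoordRingDeg_iff.1 hy
    refine ⟨⟨Ideal.Quotient.mk _ F, mem_orbitCoordRingDeg_iff.2 ⟨F, hF, rfl⟩⟩, ?_⟩
    apply Subtype.ext
    simp [ψ, LinearMap.restrict_apply]

/-! ### API -/

/-- No form obstructs itself: the identity is a surjective intertwiner. [folklore] -/
theorem not_hasMultiplicityObstruction_self (f : MvPolynomial σ k) (m d : ℕ) :
    ¬ HasMultiplicityObstruction f f m d :=
  fun h => h ⟨IntertwiningMap.id _, Function.surjective_id⟩

/-- Unfolding `HasMultiplicityObstruction` in the requested unbundled form: no `k`-linear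
surjection `φ` with `φ ∘ ρ_f(A) = ρ_g(A) ∘ φ` for all `A : GL σ k`. [Bürgisser–Ikenmeyer–Panova
2019, §1] [folklore] -/
theorem hasMultiplicityObstruction_iff (f g : MvPolynomial σ k) (m d : ℕ) :
    HasMultiplicityObstruction f g m d ↔
      ¬ ∃ φ : orbitCoordRingDeg f m d →ₗ[k] orbitCoordRingDeg g m d,
        Function.Surjective φ ∧
          ∀ A : GL σ k, φ ∘ₗ orbitCoordRepDeg f m d A = orbitCoordRepDeg g m d A ∘ₗ φ := by
  unfold HasMultiplicityObstruction
  refine not_congr ⟨?_, ?_⟩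
  · rintro ⟨φ, hφ⟩
    exact ⟨φ.toLinearMap, hφ, φ.isIntertwining'⟩
  · rintro ⟨φ, hφ, hA⟩
    exact ⟨⟨φ, hA⟩, hφ⟩

/-- Over `ℂ`, occurrence obstructions are multiplicity obstructions: if an irreducible `W ≤ ℂ[Δ[g]]_d`
has no nonzero intertwiner to `ℂ[Δ[f]]_d`, then no equivariant surjection
`ℂ[Δ[f]]_d ↠ ℂ[Δ[g]]_d` exists (by complete reducibility of rational `GL`-modules a surjection
would split, embedding `W` equivariantly into `ℂ[Δ[f]]_d`). Needs semisimplicity of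
`GL_N(ℂ)`-modules, not in the tree; recorded as a named fact.
[Bürgisser–Ikenmeyer–Panova 2019, §1 ("occurrence obstructions are multiplicity
obstructions")] [cite: BurgisserIkenmeyerPanova2019, §1] -/
def hasMultiplicityObstruction_of_hasOccurrenceObstruction_complex : Prop :=
  ∀ {σ : Type} [Fintype σ] [DecidableEq σ] {f g : MvPolynomial σ ℂ} {m d : ℕ}
    (_hf : f.IsHomogeneous m) (_hg : g.IsHomogeneous m) (_h : HasOccurrenceObstruction f g m d),
    HasMultiplicityObstruction f g m d

end Literature.Computability.AlgebraicComplexity
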